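import Summits.AnomalousDissipation.AnomalousDissipation.Theorems.MomentParityGalerkinInvariantLoudStubKrylovBogoliubovA
import Summits.AnomalousDissipation.AnomalousDissipation.Theorems.MomentParityMomentClosure
import Mathlib.MeasureTheory.Integral.IntervalIntegral.Basic
import Mathlib.Order.Filter.AtTopBot.Archimedean

/-!
# Stub `stub_krylovBogoliubov` (S3) of the line `taylor-cone-homogenisation`
# (crux stmt-AnomalousDissipation-14283, `MomentParity.GalerkinInvariantLoud`): Krylov–Bogoliubov at level `N`, ratio form

**S3.** For `ν > 0`, a smooth divergence-free mean-zero force `f`, a level `N`, a real `κ` and a mean-zero Galerkin datum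
`a` of order `N` whose orbit `u(t) = galerkinFlow ν f N t a` has cumulative Taylor ratio
`liminf_T ν∫₀ᵀ‖∇u‖² / ∫₀ᵀ|u|² ≥ κ`, some Borel probability law on `H = L²_σ(T³)` is level-`N` carried, carried by the
absorbing ball `‖u‖ ≤ ‖f‖₂/(4π²ν)`, all-order polynomially stationary for Galerkin NS at `(ν, f)` and in the cone
`κ·e(μ) ≤ D(μ)`. Three layers:

* §1 ABSTRACT KRYLOV–BOGOLIUBOV (no Galerkin content). The Cesàro measures `(ofReal T)⁻¹ • (volume|_(0,T]).map V` of a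
  continuous path `V` in a compact `K` are probability measures carried by `K` whose integrals are time means
  (`isProbabilityMeasure_cesaro`, `ae_mem_cesaro`, `integral_cesaro`); along `T_n = n + 1` the tree lemma
  `exists_limit_measure_of_isCompact` hands a cluster measure `μ'` inheriting every CLOSED eventual constraint on the time
  means of continuous observables (`exists_cesaro_limit`); bounded increments give vanishing rows
  (`integral_eq_zero_of_cesaro`) and a cumulative-ratio floor gives the cone (`mul_integral_le_integral_of_liminf`).
* §2 DERIVATIVES ALONG THE LIFTED ORBIT (helper A supplies the lift `U t = [realTrigPoly c̄(t)] ∈ H` of the coefficient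
  orbit, level-`N`, continuous, in a compact level ball by the uniform energy bound): `d/dt (U t, b) = ⟨F(U t), b⟩` for band
  tests (`nsGeneratorPairing_eq_sum_re_inner_galerkinField`), the chain rule through polynomials (`hasFDerivAt_eval`,
  `nsGeneratorPairing_polyGrad`), and `∫₀ᵀ ⟨F(U t), ∇p(U t)⟩ dt = P(coords U T) − P(coords U 0)` (a bounded increment).
* §3 THE STUB: rows from §1–§2, the cone from the ratio floor (`D(μ') = ν∫ bandEnstrophy dμ'` by
  `lintegral_eGradNormSq_eq`), the absorbing radius from invariance alone (`ae_norm_le_absorbing`, `norm_toLp_eq_sqrt`).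

Folklore (Krylov–Bogoliubov 1937; Foias–Manley–Rosa–Temam 2001, Ch. IV §2–3 and App. B; Constantin–Foias 1988, Ch. 8).
-/

set_option linter.dupNamespace false

noncomputable section

namespace Summit.AnomalousDissipation.AnomalousDissipation.Theorems.GalerkinInvariantLoud.KrylovBogoliubov

open MeasureTheory Filter Topology Set UnitAddTorus
open scoped ENNReal InnerProductSpace RealInnerProductSpace
open Literature.Analysis.FunctionSpaces Literature.Analysis.FluidPDE
open Summit.AnomalousDissipation.AnomalousDissipation.Theses.MomentParity
open Summit.AnomalousDissipation.AnomalousDissipation.Theorems.QuarticGate.Negative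
open Summit.AnomalousDissipation.AnomalousDissipation.Theorems.CubicParityLoud.Negative (T3 R3 H3 L2T3 norm_toLp_eq_sqrt)
open Summit.AnomalousDissipation.AnomalousDissipation.Theorems.MomentParity
  (toLp_realTrigPoly_mem_energySpace nsGeneratorPairing_eq_sum_re_inner_galerkinField band_of_band₀)
open Summit.AnomalousDissipation.AnomalousDissipation.Theorems.MomentParityMomentClosure
  (exists_limit_measure_of_isCompact isCompact_levelBall continuous_nsGeneratorPairing_polyGrad nsGeneratorPairing_polyGrad
   continuous_eval_pderiv continuous_bandEnstrophy bandEnstrophy_nonneg lintegral_eGradNormSq_eq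
   integrable_of_continuous_of_ae_mem)
open Summit.AnomalousDissipation.AnomalousDissipation.Theorems.GalerkinInvariantLoud.Negative (IsInvariant ae_norm_le_absorbing)

/-! ## §1 The abstract Krylov–Bogoliubov step -/

section Cesaro

variable {X : Type*} [MeasurableSpace X]

/-- **The Cesàro measure `T⁻¹ ∫₀ᵀ δ_{V t} dt` is a probability measure** (`T > 0`, `V` measurable). [folklore] -/
theorem isProbabilityMeasure_cesaro {V : ℝ → X} (hV : Measurable V) {T : ℝ} (hT : 0 < T) :
    IsProbabilityMeasure ((ENNReal.ofReal T)⁻¹ • (volume.restrict (Ioc (0 : ℝ) T)).map V) := by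
  refine ⟨?_⟩
  rw [Measure.smul_apply, Measure.map_apply hV MeasurableSet.univ, preimage_univ, Measure.restrict_apply_univ,
    Real.volume_Ioc, sub_zero, smul_eq_mul, ENNReal.inv_mul_cancel]
  · exact (ENNReal.ofReal_pos.2 hT).ne'
  · exact ENNReal.ofReal_ne_top

/-- A Cesàro measure of a path with values in a measurable set `K` is carried by `K`. [folklore] -/
theorem ae_mem_cesaro {V : ℝ → X} (hV : Measurable V) {K : Set X} (hK : MeasurableSet K) (hVK : ∀ t, V t ∈ K)
    (r : ℝ≥0∞) (ρ : Measure ℝ) : ∀ᵐ x ∂(r • ρ.map V), x ∈ K :=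
  Measure.ae_smul_measure ((ae_map_iff hV.aemeasurable hK).2 (Eventually.of_forall fun t => hVK t)) r

/-- **Integrals against a Cesàro measure are time means**: `∫ F dμ_T = T⁻¹ ∫₀ᵀ F (V t) dt` for continuous `F`. [folklore] -/
theorem integral_cesaro [TopologicalSpace X] [OpensMeasurableSpace X] {V : ℝ → X} (hV : Measurable V) {F : X → ℝ} (hF : Continuous F)
    {T : ℝ} (hT : 0 < T) :
    ∫ x, F x ∂((ENNReal.ofReal T)⁻¹ • (volume.restrict (Ioc (0 : ℝ) T)).map V) = T⁻¹ * ∫ t in (0 : ℝ)..T, F (V t) := by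
  rw [integral_smul_measure, integral_map hV.aemeasurable hF.aestronglyMeasurable, ENNReal.toReal_inv,
    ENNReal.toReal_ofReal hT.le, intervalIntegral.integral_of_le hT.le, smul_eq_mul]

/-- **Krylov–Bogoliubov, abstract form.** A continuous path `V : ℝ → X` into a Hausdorff Borel space with values in a
compact set `K` admits a Borel probability measure `μ'` carried by `K` such that, for every continuous `F : X → ℝ` and
every closed `C ⊆ ℝ` containing the time means `(n+1)⁻¹ ∫₀^{n+1} F (V t) dt` for all large `n`, `∫ F dμ' ∈ C`
(a weak-* cluster point of the Cesàro measures along `T_n = n + 1`; `exists_limit_measure_of_isCompact`). [folklore] -/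
theorem exists_cesaro_limit [TopologicalSpace X] [T2Space X] [BorelSpace X] {K : Set X} (hK : IsCompact K) {V : ℝ → X}
    (hV : Continuous V) (hVK : ∀ t, V t ∈ K) :
    ∃ μ' : Measure X, IsProbabilityMeasure μ' ∧ (∀ᵐ x ∂μ', x ∈ K) ∧
      ∀ (F : X → ℝ), Continuous F → ∀ (C : Set ℝ), IsClosed C →
        (∀ᶠ n : ℕ in atTop, ((n : ℝ) + 1)⁻¹ * ∫ t in (0 : ℝ)..((n : ℝ) + 1), F (V t) ∈ C) → (∫ x, F x ∂μ') ∈ C := by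
  have hVm : Measurable V := hV.measurable
  have hpos : ∀ n : ℕ, (0 : ℝ) < (n : ℝ) + 1 := fun n => by positivity
  obtain ⟨μ', h1, h2, h3⟩ := exists_limit_measure_of_isCompact hK
    (fun n : ℕ => (ENNReal.ofReal ((n : ℝ) + 1))⁻¹ • (volume.restrict (Ioc (0 : ℝ) ((n : ℝ) + 1))).map V)
    (fun n => isProbabilityMeasure_cesaro hVm (hpos n))
    (fun n => ae_mem_cesaro hVm hK.isClosed.measurableSet hVK _ _)
  refine ⟨μ', h1, h2, fun F hF C hC hev => h3 F hF C hC ?_⟩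
  filter_upwards [hev] with n hn
  rwa [integral_cesaro hVm hF (hpos n)]

/-- **Invariance rows pass to the cluster measure.** If the time integrals of an observable `F` along the path are
increments `∫₀ᵀ F (V t) dt = Φ T − Φ 0` of a function bounded on `[0, ∞)`, then the time means tend to `0`, so every
cluster measure in the sense of `exists_cesaro_limit` has `∫ F dμ' = 0`. [folklore] -/
theorem integral_eq_zero_of_cesaro {V : ℝ → X} {F : X → ℝ} {μ' : Measure X}
    (hlim : ∀ C : Set ℝ, IsClosed C →
      (∀ᶠ n : ℕ in atTop, ((n : ℝ) + 1)⁻¹ * ∫ t in (0 : ℝ)..((n : ℝ) + 1), F (V t) ∈ C) → (∫ x, F x ∂μ') ∈ C)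
    {Φ : ℝ → ℝ} {B : ℝ} (hΦ : ∀ T, 0 ≤ T → ∫ t in (0 : ℝ)..T, F (V t) = Φ T - Φ 0)
    (hB : ∀ t, 0 ≤ t → |Φ t| ≤ B) : ∫ x, F x ∂μ' = 0 := by
  have hsmall : ∀ δ : ℝ, 0 < δ → |∫ x, F x ∂μ'| ≤ δ := by
    intro δ hδ
    have hmem : (∫ x, F x ∂μ') ∈ Icc (-δ) δ := by
      refine hlim _ isClosed_Icc ?_
      filter_upwards [(tendsto_atTop_add_const_right _ 1 tendsto_natCast_atTop_atTop).eventually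
        (eventually_ge_atTop (2 * B / δ))] with n hn
      have hn0 : (0 : ℝ) < (n : ℝ) + 1 := by positivity
      rw [hΦ _ hn0.le, mem_Icc, ← abs_le, abs_mul, abs_inv, abs_of_pos hn0, inv_mul_le_iff₀ hn0]
      have h1 : |Φ ((n : ℝ) + 1) - Φ 0| ≤ 2 * B := by
        calc |Φ ((n : ℝ) + 1) - Φ 0| ≤ |Φ ((n : ℝ) + 1)| + |Φ 0| := abs_sub _ _
          _ ≤ B + B := add_le_add (hB _ hn0.le) (hB 0 le_rfl)
          _ = 2 * B := by ring
      have h2 : 2 * B ≤ ((n : ℝ) + 1) * δ := by rwa [div_le_iff₀ hδ] at hn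
      exact h1.trans h2
    exact abs_le.2 ⟨hmem.1, hmem.2⟩
  have h0 : |∫ x, F x ∂μ'| ≤ 0 := le_of_forall_gt_imp_ge_of_dense hsmall
  exact abs_eq_zero.1 (le_antisymm h0 (abs_nonneg _))

/-- **The cumulative-ratio floor passes to the cone inequality.** For nonnegative continuous observables `D`, `E`,
integrable under a cluster measure `μ'` of the path `V` (in the sense of `exists_cesaro_limit`), a floor
`κ ≤ liminf_{T → ∞} ∫₀ᵀ D (V t) dt / ∫₀ᵀ E (V t) dt` gives `κ ∫ E dμ' ≤ ∫ D dμ'`: for every `κ' < κ` the time means of the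
continuous observable `D − κ' E` are eventually `≥ 0` (closed constraint), and `κ' ↑ κ` (trivial when `∫ E dμ' = 0`).
No sign of `κ` is needed. [folklore] -/
theorem mul_integral_le_integral_of_liminf [TopologicalSpace X] {V : ℝ → X} (hV : Continuous V) {D E : X → ℝ} (hD : Continuous D)
    (hE : Continuous E) (hD0 : ∀ x, 0 ≤ D x) (hE0 : ∀ x, 0 ≤ E x) {μ' : Measure X} (hDi : Integrable D μ')
    (hEi : Integrable E μ')
    (hlim : ∀ (F : X → ℝ), Continuous F → ∀ (C : Set ℝ), IsClosed C →
      (∀ᶠ n : ℕ in atTop, ((n : ℝ) + 1)⁻¹ * ∫ t in (0 : ℝ)..((n : ℝ) + 1), F (V t) ∈ C) → (∫ x, F x ∂μ') ∈ C)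
    {κ : ℝ} (hκ : κ ≤ liminf (fun T : ℝ => (∫ t in (0 : ℝ)..T, D (V t)) / ∫ t in (0 : ℝ)..T, E (V t)) atTop) :
    κ * ∫ x, E x ∂μ' ≤ ∫ x, D x ∂μ' := by
  have hDV : Continuous fun t => D (V t) := hD.comp hV
  have hEV : Continuous fun t => E (V t) := hE.comp hV
  -- every `κ' < κ` is admissible
  have key : ∀ κ', κ' < κ → κ' * ∫ x, E x ∂μ' ≤ ∫ x, D x ∂μ' := by
    intro κ' hκ'
    have hbdd : IsBoundedUnder (· ≥ ·) atTop
        (fun T : ℝ => (∫ t in (0 : ℝ)..T, D (V t)) / ∫ t in (0 : ℝ)..T, E (V t)) := by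
      refine ⟨0, ?_⟩
      rw [eventually_map]
      filter_upwards [eventually_ge_atTop (0 : ℝ)] with T hT
      exact div_nonneg (intervalIntegral.integral_nonneg hT fun t _ => hD0 _)
        (intervalIntegral.integral_nonneg hT fun t _ => hE0 _)
    have hev := eventually_lt_of_lt_liminf (hκ'.trans_le hκ) hbdd
    have hevn : ∀ᶠ n : ℕ in atTop,
        ((n : ℝ) + 1)⁻¹ * ∫ t in (0 : ℝ)..((n : ℝ) + 1), (D (V t) - κ' * E (V t)) ∈ Ici 0 := by
      filter_upwards [(tendsto_atTop_add_const_right _ 1 tendsto_natCast_atTop_atTop).eventually hev] with n hn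
      have hn0 : (0 : ℝ) < (n : ℝ) + 1 := by positivity
      rw [intervalIntegral.integral_sub (hDV.intervalIntegrable _ _) ((hEV.intervalIntegrable _ _).const_mul κ'),
        intervalIntegral.integral_const_mul]
      refine mul_nonneg (inv_nonneg.2 hn0.le) (sub_nonneg.2 ?_)
      have he : 0 ≤ ∫ t in (0 : ℝ)..((n : ℝ) + 1), E (V t) :=
        intervalIntegral.integral_nonneg hn0.le fun t _ => hE0 _
      rcases he.eq_or_lt with he0 | hepos
      · rw [← he0, mul_zero]
        exact intervalIntegral.integral_nonneg hn0.le fun t _ => hD0 _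
      · exact ((lt_div_iff₀ hepos).1 hn).le
    have h := hlim (fun x => D x - κ' * E x) (hD.sub (continuous_const.mul hE)) (Ici 0) isClosed_Ici hevn
    rw [mem_Ici, integral_sub hDi (hEi.const_mul κ'), integral_const_mul] at h
    linarith
  -- let `κ' ↑ κ`
  have hE0' : 0 ≤ ∫ x, E x ∂μ' := integral_nonneg hE0
  rcases hE0'.eq_or_lt with he0 | hepos
  · rw [← he0, mul_zero]
    exact integral_nonneg hD0
  · have : κ ≤ (∫ x, D x ∂μ') / ∫ x, E x ∂μ' :=
      le_of_forall_lt_imp_le_of_dense fun κ' hκ' => (le_div_iff₀ hepos).2 (key κ' hκ')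
    exact (le_div_iff₀ hepos).1 this

end Cesaro

variable {ν : ℝ} {f a : T3 → R3} {N : ℕ} {c : ℝ → ↥(Torus.freqBall (d := Fin 3) N) → EuclideanSpace ℂ (Fin 3)}

/-! ## §2 Derivatives of the tested pairings along the lifted orbit -/

/-- Derivative of a finite sum of coefficient pairings `Σ_k Re⟪c t k, w k⟫` along a differentiable coefficient path.
[folklore] -/
theorem hasDerivAt_sum_re_inner {c' : ↥(Torus.freqBall (d := Fin 3) N) → EuclideanSpace ℂ (Fin 3)} {t : ℝ}
    (h : HasDerivAt c c' t) (w : ↥(Torus.freqBall (d := Fin 3) N) → EuclideanSpace ℂ (Fin 3)) :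
    HasDerivAt (fun τ => ∑ k, (inner ℂ (c τ k) (w k)).re) (∑ k, (inner ℂ (c' k) (w k)).re) t := by
  refine HasDerivAt.fun_sum fun k _ => ?_
  have hk : HasDerivAt (fun τ => c τ k) (c' k) t :=
    (ContinuousLinearMap.proj (R := ℝ) (φ := fun _ : ↥(Torus.freqBall (d := Fin 3) N) => EuclideanSpace ℂ (Fin 3))
      k).hasFDerivAt.comp_hasDerivAt t h
  have h2 := hk.inner ℂ (hasDerivAt_const t (w k))
  simp only [inner_zero_right, zero_add] at h2
  have h3 := Complex.reCLM.hasFDerivAt.comp_hasDerivAt t h2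
  simpa [Function.comp_def] using h3

section Orbit

variable (hc : IsGalerkinODESolution ν (fourierRestrict (Torus.freqBall N) f) (fourierRestrict (Torus.freqBall N) a) c)
  {U : ℝ → H3}
  (hU : ∀ t, (U t).1 = (Torus.memLp_realTrigPoly (Torus.freqBall N) (Torus.coeffExt (Torus.freqBall N) (c t)) 2).toLp _)
  (hcm : ∀ t, c t ∈ galerkinSubspace (Torus.freqBall N)) (h0 : ∀ t, c t ⟨0, Torus.zero_mem_freqBall N⟩ = 0)
include hc hU hcm h0

/-- **The tested Galerkin equations in differential form on `H`**: along the lifted orbit `U`, for a band test `b` of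
level `N`, `d/dt (U t, b) = ⟨F(U t), b⟩` at every `t > 0` (the Galerkin ODE in coefficients and
`nsGeneratorPairing_eq_sum_re_inner_galerkinField`). [folklore] -/
theorem hasDerivAt_pairing_lift (hf2 : MemLp f 2 volume) {b : T3 → R3} (hb : IsBandTest N b) {t : ℝ} (ht : 0 < t) :
    HasDerivAt (fun τ => Torus.pairing (U τ).1 b) (Torus.nsGeneratorPairing ν f (U t) b) t := by
  have hbB : ∀ k ∉ Torus.freqBall N, mFourierCoeff (EuclideanSpace.complexify ∘ b) k = 0 := band_of_band₀ hb.2.2.2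
  have hder := hasDerivAt_sum_re_inner (hc.hasDerivAt ht) (fun k => mFourierCoeff (EuclideanSpace.complexify ∘ b) k)
  have hfun : (fun τ => Torus.pairing (U τ).1 b) =
      fun τ => ∑ k, (inner ℂ (c τ k) (mFourierCoeff (EuclideanSpace.complexify ∘ b) k)).re :=
    funext fun τ => pairing_lift hU hcm h0 (hb.1.memLp 2) hbB τ
  rw [hfun]
  refine hder.congr_deriv ?_
  rw [nsGeneratorPairing_eq_sum_re_inner_galerkinField ν hf2 _ (isLevel_lift hU hcm h0 t) hb.1 hb.2.1 hbB,
    fourierRestrict_lift hU hcm h0]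
  exact Finset.sum_coe_sort (Torus.freqBall N) fun k => (inner ℂ (Torus.galerkinField ν (Torus.freqBall N)
    (Torus.coeffExt (Torus.freqBall N) (fourierRestrict (Torus.freqBall N) f))
    (Torus.coeffExt (Torus.freqBall N) (c t)) k) (mFourierCoeff (EuclideanSpace.complexify ∘ b) k)).re

/-- **Chain rule for polynomial observables along the orbit**: for band tests `g` and a polynomial `P`,
`d/dt P((U t, g₁), …, (U t, gₘ)) = ⟨F(U t), ∇p(U t)⟩` at every `t > 0`. [folklore] -/
theorem hasDerivAt_eval_lift (hf2 : MemLp f 2 volume) {m : ℕ} {g : Fin m → T3 → R3} (hg : ∀ i, IsBandTest N (g i))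
    (P : MvPolynomial (Fin m) ℝ) {t : ℝ} (ht : 0 < t) :
    HasDerivAt (fun τ => MvPolynomial.eval (fun j => Torus.pairing (U τ).1 (g j)) P)
      (Torus.nsGeneratorPairing ν f (U t) (polyGrad g P (U t))) t := by
  have hx : HasDerivAt (fun τ => fun j => Torus.pairing (U τ).1 (g j))
      (fun j => Torus.nsGeneratorPairing ν f (U t) (g j)) t :=
    hasDerivAt_pi.2 fun j => hasDerivAt_pairing_lift hc hU hcm h0 hf2 (hg j) ht
  have h := (Literature.NumberTheory.Transcendental.hasFDerivAt_eval P _).comp_hasDerivAt t hx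
  have e : Torus.nsGeneratorPairing ν f (U t) (polyGrad g P (U t)) =
      ∑ i, MvPolynomial.eval (fun j => Torus.pairing (U t).1 (g j)) (MvPolynomial.pderiv i P) *
        Torus.nsGeneratorPairing ν f (U t) (g i) :=
    nsGeneratorPairing_polyGrad ν (hf2.integrable one_le_two) (fun i => (hg i).1) P _
  rw [e]
  refine h.congr_deriv ?_
  simp

/-- **Drift of polynomial observables integrates to a boundary term**: for `T ≥ 0`,
`∫₀ᵀ ⟨F(U t), ∇p(U t)⟩ dt = P(coords U T) − P(coords U 0)` (FTC with right derivatives; the lift is continuous).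
[folklore] -/
theorem integral_nsGeneratorPairing_polyGrad_lift (hf2 : MemLp f 2 volume)
    (hneg : ∀ t, t ≤ 0 → c t = fourierRestrict (Torus.freqBall N) a) {m : ℕ} {g : Fin m → T3 → R3}
    (hg : ∀ i, IsBandTest N (g i)) (P : MvPolynomial (Fin m) ℝ) {T : ℝ} (hT : 0 ≤ T) :
    ∫ t in (0 : ℝ)..T, Torus.nsGeneratorPairing ν f (U t) (polyGrad g P (U t)) =
      MvPolynomial.eval (fun j => Torus.pairing (U T).1 (g j)) P -
        MvPolynomial.eval (fun j => Torus.pairing (U 0).1 (g j)) P := by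
  have hUc : Continuous U := continuous_lift hU (continuous_of_isGalerkinODESolution hc hneg)
  have hgs : ∀ i, Torus.IsSmooth (g i) := fun i => (hg i).1
  refine intervalIntegral.integral_eq_sub_of_hasDeriv_right_of_le (E := ℝ) hT
    (f := fun τ => MvPolynomial.eval (fun j => Torus.pairing (U τ).1 (g j)) P) ?_ ?_ ?_
  · exact ((continuous_eval_pderiv hgs P).comp hUc).continuousOn
  · intro t ht
    exact (hasDerivAt_eval_lift hc hU hcm h0 hf2 hg P ht.1).hasDerivWithinAt
  · have hFc : Continuous fun u : H3 => Torus.nsGeneratorPairing ν f u (polyGrad g P u) :=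
      continuous_nsGeneratorPairing_polyGrad ν (hf2.integrable one_le_two) hgs P
    exact (hFc.comp hUc).intervalIntegrable _ _

end Orbit

/-! ## §3 The stub -/

/-- **S3 — Krylov–Bogoliubov at level `N`, ratio form** (shared support lemma of the lines
`taylor-cone-homogenisation`, `conley-continuation-loud-saddles`, `rayleigh-floor-one-trajectory`). For `ν > 0`, a smooth
divergence-free mean-zero force `f`, a level `N`, a real `κ` and a mean-zero Galerkin datum `a` of order `N` whose orbit
`u(t) = galerkinFlow ν f N t a` has cumulative Taylor ratio `liminf_T ν∫₀ᵀ‖∇u‖² / ∫₀ᵀ|u|² ≥ κ`, some Borel probability law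
on `H` is level-`N` carried, carried by the absorbing ball `‖u‖ ≤ ‖f‖₂/(4π²ν)`, all-order invariant for Galerkin NS at
`(ν, f)` and in the cone `κ·e(μ) ≤ D(μ)`. Proof: lift the orbit to `H` (helper A: conserved mean mode, uniform energy
bound, so the orbit lies in the compact level ball `K`), take a weak-* cluster point of the Cesàro measures along
`T_n = n + 1` (§1), pass the rows (each row is the time derivative of a bounded polynomial observable) and the ratio
floor through closed constraints, and read off the absorbing radius from invariance (`ae_norm_le_absorbing`). [folklore] -/
theorem stub_krylovBogoliubov :
    ∀ (ν : ℝ) (f : UnitAddTorus (Fin 3) → EuclideanSpace ℝ (Fin 3)) (N : ℕ) (κ : ℝ)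
      (a : UnitAddTorus (Fin 3) → EuclideanSpace ℝ (Fin 3)),
      0 < ν → Torus.IsSmooth f → Torus.IsDivFree f → Torus.HasZeroMean f →
      IsGalerkinMode N a → Torus.HasZeroMean a →
      κ ≤ Filter.liminf (fun T : ℝ =>
          (ν * (∫⁻ t in Ioo 0 T, Torus.eGradNormSq (Torus.galerkinFlow ν f N t a)).toReal) /
            (∫ t in (0 : ℝ)..T, ∫ x, ‖Torus.galerkinFlow ν f N t a x‖ ^ 2)) atTop →
      ∃ μ : Measure (Torus.energySpace (Fin 3)),
        IsProbabilityMeasure μ ∧ (∀ᵐ u ∂μ, IsLevel N u) ∧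
        (∀ᵐ u ∂μ, ‖u‖ ≤ Real.sqrt (∫ x, ‖f x‖ ^ 2) / (4 * Real.pi ^ 2 * ν)) ∧
        (∀ d : ℕ, IsPolyStationary ν f N d μ) ∧
        κ * Torus.ensembleEnergy μ ≤ Torus.ensembleDissipation ν μ := by
  intro ν f N κ a hν hfs _hfd hfz ha ha0 hlim
  have hS : ∀ k ∈ Torus.freqBall (d := Fin 3) N, -k ∈ Torus.freqBall N := Torus.neg_mem_freqBall_of_mem
  have hfi : Integrable f volume := hfs.integrable
  have hf2 : MemLp f 2 volume := hfs.memLp 2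
  -- (A) the coefficient orbit and its lift to `H`
  set c : ℝ → ↥(Torus.freqBall (d := Fin 3) N) → EuclideanSpace ℂ (Fin 3) := fun t =>
    galerkinCoeffFlow ν (fourierRestrict (Torus.freqBall N) f) t (fourierRestrict (Torus.freqBall N) a) with hc_def
  have hc : IsGalerkinODESolution ν (fourierRestrict (Torus.freqBall N) f) (fourierRestrict (Torus.freqBall N) a) c :=
    isGalerkinODESolution_galerkinCoeffFlow hν.le hS (Torus.isRealCoeff_mFourierCoeff hfi) ha.fourierRestrict_mem
  have hneg : ∀ t, t ≤ 0 → c t = fourierRestrict (Torus.freqBall N) a := fun t ht => galerkinCoeffFlow_of_nonpos ht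
  have hcm : ∀ t, c t ∈ galerkinSubspace (Torus.freqBall N) := hc.mem
  have h0 : ∀ t, c t ⟨0, Torus.zero_mem_freqBall N⟩ = 0 := apply_zero_of_isGalerkinODESolution hfi hfz ha ha0 hc hneg
  have hu : ∀ t, Torus.galerkinFlow ν f N t a =
      Torus.realTrigPoly (Torus.freqBall N) (Torus.coeffExt (Torus.freqBall N) (c t)) := fun t => ha.galerkinFlow_eq t
  set U : ℝ → H3 := fun t =>
    ⟨(Torus.memLp_realTrigPoly (Torus.freqBall N) (Torus.coeffExt (Torus.freqBall N) (c t)) 2).toLp _,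
      (toLp_realTrigPoly_mem_energySpace (hcm t) (h0 t)).1⟩ with hU_def
  have hU : ∀ t, (U t).1 =
      (Torus.memLp_realTrigPoly (Torus.freqBall N) (Torus.coeffExt (Torus.freqBall N) (c t)) 2).toLp _ := fun t => rfl
  have hUc : Continuous U := continuous_lift hU (continuous_of_isGalerkinODESolution hc hneg)
  have hlev : ∀ t, IsLevel N (U t) := isLevel_lift hU hcm h0
  -- the uniform bound and the compact carrier
  set M : ℝ := max (∑ k, ‖fourierRestrict (Torus.freqBall N) a k‖ ^ 2)
    ((∫ x, ‖f x‖ ^ 2) / (4 * Real.pi ^ 2 * ν) ^ 2) with hM_def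
  set R : ℝ := Real.sqrt M with hR_def
  have hR : 0 ≤ R := Real.sqrt_nonneg _
  have hUR : ∀ t, ‖U t‖ ≤ R := fun t => by
    rw [hR_def, ← Real.sqrt_sq (norm_nonneg (U t)), norm_lift_sq hU hcm t]
    exact Real.sqrt_le_sqrt (energy_le_of_isGalerkinODESolution hν hf2 hc hneg h0 t)
  set K : Set H3 := {u : H3 | IsLevel N u ∧ ‖u‖ ≤ R} with hK_def
  have hK : IsCompact K := isCompact_levelBall N hR
  have hUK : ∀ t, U t ∈ K := fun t => ⟨hlev t, hUR t⟩
  -- (B) the cluster measure of the Cesàro averages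
  obtain ⟨μ', hμ'P, hμ'K, hlimμ⟩ := exists_cesaro_limit hK hUc hUK
  haveI := hμ'P
  have hμ'L : ∀ᵐ u ∂μ', IsLevel N u := hμ'K.mono fun u hu => hu.1
  have hμ'R : ∀ᵐ u ∂μ', ‖u‖ ≤ R := hμ'K.mono fun u hu => hu.2
  -- (C1) all-order rows
  have hrow : ∀ (m : ℕ) (g : Fin m → T3 → R3) (P : MvPolynomial (Fin m) ℝ), (∀ i, IsBandTest N (g i)) →
      Integrable (fun u => Torus.nsGeneratorPairing ν f u (polyGrad g P u)) μ' ∧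
        ∫ u, Torus.nsGeneratorPairing ν f u (polyGrad g P u) ∂μ' = 0 := by
    intro m g P hg
    have hgs : ∀ i, Torus.IsSmooth (g i) := fun i => (hg i).1
    have hFc : Continuous fun u : H3 => Torus.nsGeneratorPairing ν f u (polyGrad g P u) :=
      continuous_nsGeneratorPairing_polyGrad ν hfi hgs P
    refine ⟨integrable_of_continuous_of_ae_mem hK hμ'K hFc, ?_⟩
    have hΦc : Continuous fun u : H3 => MvPolynomial.eval (fun j => Torus.pairing u.1 (g j)) P :=
      continuous_eval_pderiv hgs P
    obtain ⟨B, hB⟩ := hK.exists_bound_of_continuousOn hΦc.continuousOn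
    refine integral_eq_zero_of_cesaro (hlimμ _ hFc)
      (Φ := fun t => MvPolynomial.eval (fun j => Torus.pairing (U t).1 (g j)) P)
      (fun T hT => integral_nsGeneratorPairing_polyGrad_lift hc hU hcm h0 hf2 hneg hg P hT) (B := B) fun t _ => ?_
    have h := hB (U t) (hUK t)
    rwa [Real.norm_eq_abs] at h
  have hinv : IsInvariant ν f N μ' := fun m g P hg => hrow m g P hg
  refine ⟨μ', hμ'P, hμ'L, ?_, fun d m g P hg _ => hrow m g P hg, ?_⟩
  · -- (C2) the absorbing radius, from invariance
    have h := ae_norm_le_absorbing hν hf2 hμ'L hμ'R hinv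
    rwa [norm_toLp_eq_sqrt] at h
  · -- (C3) the cone inequality
    set bandE : H3 → ℝ := fun u => 4 * Real.pi ^ 2 * ∑ k ∈ Torus.freqBall N, Torus.freqNormSq k *
      ‖mFourierCoeff (EuclideanSpace.complexify ∘ ((u : H3).1 : T3 → R3)) k‖ ^ 2 with hbandE_def
    have hbc : Continuous bandE := continuous_bandEnstrophy _
    have hb0 : ∀ u, 0 ≤ bandE u := fun u => bandEnstrophy_nonneg _ u
    have hD : Continuous fun u => ν * bandE u := continuous_const.mul hbc
    have hE : Continuous fun u : H3 => ‖u‖ ^ 2 := continuous_norm.pow 2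
    have hD0 : ∀ u, 0 ≤ ν * bandE u := fun u => mul_nonneg hν.le (hb0 u)
    have hE0 : ∀ u : H3, 0 ≤ ‖u‖ ^ 2 := fun u => sq_nonneg _
    have hDi : Integrable (fun u => ν * bandE u) μ' := integrable_of_continuous_of_ae_mem hK hμ'K hD
    have hEi : Integrable (fun u : H3 => ‖u‖ ^ 2) μ' := integrable_of_continuous_of_ae_mem hK hμ'K hE
    -- the orbit quantities in terms of the lift
    have hgrad : ∀ t, Torus.eGradNormSq (Torus.galerkinFlow ν f N t a) = ENNReal.ofReal (bandE (U t)) := fun t => by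
      rw [hu t]
      exact eGradNormSq_realTrigPoly_eq_lift hU hcm h0 t
    have hener : ∀ t, ∫ x, ‖Torus.galerkinFlow ν f N t a x‖ ^ 2 = ‖U t‖ ^ 2 := fun t => by
      rw [hu t, Torus.integral_norm_sq_realTrigPoly hS ((hcm t).1.isConjSymm_coeffExt hS),
        Torus.sum_coeffExt (fun _ v => ‖v‖ ^ 2), norm_lift_sq hU hcm t]
    have hnum : ∀ T, 0 ≤ T → (ν * (∫⁻ t in Ioo 0 T, Torus.eGradNormSq (Torus.galerkinFlow ν f N t a)).toReal) =
        ∫ t in (0 : ℝ)..T, ν * bandE (U t) := by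
      intro T hT
      have hint : Integrable (fun t => bandE (U t)) (volume.restrict (Ioo 0 T)) :=
        ((hbc.comp hUc).integrableOn_Icc (a := 0) (b := T)).mono_set Ioo_subset_Icc_self
      simp_rw [hgrad]
      rw [← ofReal_integral_eq_lintegral_ofReal hint (ae_of_all _ fun t => hb0 _),
        ENNReal.toReal_ofReal (integral_nonneg fun t => hb0 _), intervalIntegral.integral_const_mul,
        intervalIntegral.integral_of_le hT, integral_Ioc_eq_integral_Ioo]
    have hκ : κ ≤ liminf (fun T : ℝ => (∫ t in (0 : ℝ)..T, ν * bandE (U t)) / ∫ t in (0 : ℝ)..T, ‖U t‖ ^ 2) atTop := by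
      refine hlim.trans_eq (liminf_congr ?_)
      filter_upwards [eventually_ge_atTop (0 : ℝ)] with T hT
      rw [hnum T hT]
      simp_rw [hener]
    have hcone := mul_integral_le_integral_of_liminf hUc hD hE hD0 hE0 hDi hEi hlimμ hκ
    -- read off `e(μ')` and `D(μ')`
    have hDμ : Torus.ensembleDissipation ν μ' = ν * ∫ u, bandE u ∂μ' := by
      rw [hbandE_def, Torus.ensembleDissipation, Torus.ensembleEnstrophy, lintegral_eGradNormSq_eq hR hμ'K,
        ENNReal.toReal_ofReal (integral_nonneg fun u => bandEnstrophy_nonneg _ u)]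
    rw [hDμ, ← integral_const_mul]
    exact hcone

end Summit.AnomalousDissipation.AnomalousDissipation.Theorems.GalerkinInvariantLoud.KrylovBogoliubov

end
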